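import Literature.NumberTheory.LFunctions.Zhang2022.KnifeEdgeLenZDegree

/-!
# Zhang (2022), rung F-S3 (Landau–Siegel programme, §D edge len = E*-len⁺): card `z-degree-toeplitz-band`
# (ls-knife-len-idea-1) — the graded design's asymptotic from the Toeplitz-band SLOTS and its POSITIVITY ENDGAME
# (PROVED), and K2's decision located by Carathéodory forcing (PROVED); companion of `KnifeEdgeLenZDegree`

Y. Zhang, *Discrete mean estimates and the Landau–Siegel zero*, arXiv:2211.02515v1 [Zhang2022LandauSiegel] —
an unrefereed manuscript under adjudication. **WHAT THIS IS NOT: not a claim about Theorems 1–2 of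
arXiv:2211.02515, about Landau–Siegel zeros, or about Parity. The programme SEARCHES and TYPES; no claim about
Landau–Siegel zeros, Theorems 1–2 of arXiv:2211.02515 or a repaired Margin232 until a kernel theorem says so.
Every `theorem` below is an implication between the bare `Prop`s of `KnifeEdgeLenZDegree` (slots `InClassMean`,
`CrossTable`, `DualCrossTable`, `TauTwoTable`, the closing alternative `GradedCloses` — asserted by no one) and
the skeleton's CLAIMS `Prop22i`, `Lemma23`; nothing is asserted.**

* Part 1 (PROVED). `discMean_gradedDesign_asymp`: the side tables (`InClassMean`), the two degree-1 tables and the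
  degree-2 table `τ₂` give, for every graded design `Σ s_k·Z^k·(base k)` and `ε > 0`, eventually under (A) — with
  Prop. 2.2 (i) and Lemma 2.3 making the weights real and `|Z| = 1` — `|Ξ(design) − q·𝔞𝔓| ≤ ε𝔞𝔓`,
  `q = gradedQuadForm (gradedMainMatrix X₁ Y₁ X₂ …) s`.
* Part 2 (PROVED). THE ENDGAME `theorem1_of_gradedCloses : InClassMean c' → CrossTable c' 1 X₁ → DualCrossTable c' 1 Y₁
  → TauTwoTable c' X₂ → GradedCloses X₁ Y₁ X₂ → Prop22i → Lemma23 c' → Theorem1` (+ Theorem 2): every discrete mean is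
  `≥ 0` (`discMean_nonneg`), a negative main constant of size `𝔞𝔓` refutes (A) — «an (A)-contradiction from a 3×3
  form, no margin fight at `θ = 1`» (the card's Assembly sketch, in its own graded currency).
* Part 3 (PROVED). K2 LOCATED: the main-term matrix is Hermitian; «not PSD on some design» ⇒ `GradedCloses`
  (`gradedCloses_of_not_posSemidef`); at a KERNEL PAIR `(f,g₁)` (singular `2×2` block: `𝔅(f)𝔅(g₁) = |X₁(f,g₁)|²`,
  the B-AH/AFE modes) Carathéodory forcing (`KnifeEdgeLenZDegree.thirdRow_forced`) gives the DICHOTOMY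
  `gradedForcing_or_closes`: EITHER `X₂(f,g₂)·conj X₁(f,g₁) = Y₁(g₁,g₂)·𝔅(f)` (the card's forced-extension identity
  «`τ₂(G,P_j) = −τ₁(G, conj Q_j)`», barrier side: B-AH one harmonic up) OR the design closes (E*-len⁺ inhabitant).

Typer: ls-knife-typer-1 (cell landau-siegel §D).

## References
* Y. Zhang, arXiv:2211.02515v1 (2022), §1 Theorems 1–2; §2 p. 6, (2.15)–(2.17), (2.32), Lemma 2.3, Prop. 2.2 (i);
  §7 Prop 7.1 (7.2); §8 (8.2)–(8.5). [cite: Zhang2022LandauSiegel, §1, §2, §7, §8]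
-/

noncomputable section

open Complex Real ComplexConjugate Matrix
open scoped ComplexOrder

namespace Literature.NumberTheory.LFunctions.Zhang2022.KnifeEdge

open Repair Skeleton

/-! ### Part 1–2 — the slots compose; the positivity endgame -/

section Endgame

variable {c' : ℝ} {X₁ Y₁ X₂ : PairFunctional}

/-- error bookkeeping for a Gram form: entrywise errors `≤ δ·A` give `≤ (Σ|s_a|)²·δ·A` (pure algebra). [folklore] -/
private theorem quadForm_error {ι : Type*} [Fintype ι] (s : ι → ℂ) (E M : ι → ι → ℂ) {δ A : ℝ}
    (h : ∀ a b, ‖E a b - M a b * A‖ ≤ δ * A) :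
    ‖(∑ a, ∑ b, s a * conj (s b) * E a b) - (∑ a, ∑ b, s a * conj (s b) * M a b) * A‖
      ≤ (∑ a, ‖s a‖) ^ 2 * (δ * A) := by
  have hre : (∑ a, ∑ b, s a * conj (s b) * E a b) - (∑ a, ∑ b, s a * conj (s b) * M a b) * A
      = ∑ a, ∑ b, s a * conj (s b) * (E a b - M a b * A) := by
    rw [Finset.sum_mul, ← Finset.sum_sub_distrib]
    refine Finset.sum_congr rfl fun a _ => ?_
    rw [Finset.sum_mul, ← Finset.sum_sub_distrib]
    refine Finset.sum_congr rfl fun b _ => ?_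
    ring
  rw [hre]
  calc ‖∑ a, ∑ b, s a * conj (s b) * (E a b - M a b * A)‖
      ≤ ∑ a, ∑ b, ‖s a‖ * ‖s b‖ * (δ * A) := by
        refine (norm_sum_le _ _).trans (Finset.sum_le_sum fun a _ => (norm_sum_le _ _).trans
          (Finset.sum_le_sum fun b _ => ?_))
        rw [norm_mul, norm_mul, Complex.norm_conj]
        exact mul_le_mul_of_nonneg_left (h a b) (by positivity)
    _ = (∑ a, ‖s a‖) ^ 2 * (δ * A) := by
        rw [sq, Finset.sum_mul_sum, Finset.sum_mul]
        refine Finset.sum_congr rfl fun a _ => ?_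
        rw [Finset.sum_mul]

/-- from the six lower-triangular entry estimates to all nine, by Hermitian symmetry (pure algebra). [folklore] -/
private theorem entries_of_lower {E M : Fin 3 → Fin 3 → ℂ} (hE : ∀ a b, E b a = conj (E a b))
    (hM : ∀ a b, M b a = conj (M a b)) {δ A : ℝ}
    (h00 : ‖E 0 0 - M 0 0 * A‖ ≤ δ * A) (h11 : ‖E 1 1 - M 1 1 * A‖ ≤ δ * A) (h22 : ‖E 2 2 - M 2 2 * A‖ ≤ δ * A)
    (h10 : ‖E 1 0 - M 1 0 * A‖ ≤ δ * A) (h20 : ‖E 2 0 - M 2 0 * A‖ ≤ δ * A) (h21 : ‖E 2 1 - M 2 1 * A‖ ≤ δ * A) :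
    ∀ a b, ‖E a b - M a b * A‖ ≤ δ * A := by
  have sym : ∀ a b, ‖E a b - M a b * A‖ ≤ δ * A → ‖E b a - M b a * A‖ ≤ δ * A := by
    intro a b h
    rw [hE a b, hM a b, ← Complex.conj_ofReal, ← map_mul, ← map_sub, Complex.norm_conj]
    exact h
  intro a b
  fin_cases a <;> fin_cases b
  · exact h00
  · exact sym _ _ h10
  · exact sym _ _ h20
  · exact h10
  · exact h11
  · exact sym _ _ h21
  · exact h20
  · exact h21
  · exact h22

/-- a real discrete mean within `δ𝔞𝔓` of its constant, read as a complex entry estimate. [folklore] -/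
private theorem entry_of_real {x m A δ : ℝ} (h : |x - m * A| ≤ δ * A) :
    ‖((x : ℝ) : ℂ) - (m : ℂ) * A‖ ≤ δ * A := by
  rw [← Complex.ofReal_mul, ← Complex.ofReal_sub, Complex.norm_real, Real.norm_eq_abs]
  exact h

/-- **THE SLOTS COMPOSE (proved):** the side tables (`InClassMean`), the two degree-1 tables and the degree-2 table
give, for every graded design and `ε > 0`, eventually under (A) — and given Prop. 2.2 (i), Lemma 2.3, which make the
weights real and `|Z| = 1` — `|Ξ(design) − q·𝔞𝔓| ≤ ε𝔞𝔓` with `q = gradedQuadForm (gradedMainMatrix …) s`.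
[cite: Zhang2022LandauSiegel, §2 (2.16)–(2.17), Lemma 2.3, Prop. 2.2 (i), §8 (8.2)–(8.5)] -/
theorem discMean_gradedDesign_asymp (h0 : InClassMean c') (h1 : CrossTable c' 1 X₁) (h21 : DualCrossTable c' 1 Y₁)
    (h2 : TauTwoTable c' X₂) (h22 : Prop22i) (h23 : Lemma23 c')
    {f f' g₁ g₁' g₂ g₂' : ℝ → ℂ} (hf : InClassPiece f f') (hg₁ : InClassPiece g₁ g₁') (hg₂ : InClassPiece g₂ g₂')
    (s : Fin 3 → ℂ) {ε : ℝ} (hε : 0 < ε) :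
    ForAllLarge fun D _ χ => AssumptionA D χ →
      |discMean c' χ (zGradedDesign χ f g₁ g₂ s)
          - gradedQuadForm (gradedMainMatrix X₁ Y₁ X₂ f f' g₁ g₁' g₂ g₂') s * frakA χ * frakP D|
        ≤ ε * frakA χ * frakP D := by
  set K : ℝ := (∑ a, ‖s a‖) ^ 2 + 1 with hK
  have hK0 : 0 < K := by positivity
  set δ : ℝ := ε / K with hδ_def
  have hδ : 0 < δ := div_pos hε hK0
  obtain ⟨D₁, hD₁⟩ := (((((((h0 f f' hf.kinked _ hδ).and (h0 g₁ g₁' hg₁.kinked _ hδ)).and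
    (h0 g₂ g₂' hg₂.kinked _ hδ)).and (h1 f f' g₁ g₁' hf hg₁ _ hδ)).and (h2 f f' g₂ g₂' hf hg₂ _ hδ)).and
    (h21 g₁ g₁' g₂ g₂' hg₁ hg₂ _ hδ)).and h22).and h23
  refine ⟨max D₁ 3, fun D _ χ hD hq hp hA => ?_⟩
  have hD3 : 3 ≤ D := le_trans (le_max_right _ _) hD
  obtain ⟨⟨⟨⟨⟨⟨⟨e00, e11⟩, e22⟩, e10⟩, e20⟩, e21⟩, h22'⟩, h23'⟩ :=
    hD₁ D χ (le_trans (le_max_left _ _) hD) hq hp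
  obtain ⟨-, -, hZ⟩ := pointwise_inputs (c' := c') χ hD3 h23' h22' fun x => psiChiPrimitive_holds D χ x hD3 hp
  -- the Gram entries `E` and the main-term matrix `M`
  set E : Fin 3 → Fin 3 → ℂ := fun a b =>
    discPolar c' χ (zGradedPiece χ f g₁ g₂ a) (zGradedPiece χ f g₁ g₂ b) with hE_def
  set M := gradedMainMatrix X₁ Y₁ X₂ f f' g₁ g₁' g₂ g₂' with hM_def
  have hEsym : ∀ a b, E b a = conj (E a b) := fun a b => (discPolar_conj_symm _ _).symm
  have hMsym : ∀ a b, M b a = conj (M a b) := by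
    intro a b
    fin_cases a <;> fin_cases b <;> simp [hM_def, gradedMainMatrix, Complex.conj_ofReal]
  have diag : ∀ (k : Fin 3) (g : ℝ → ℂ), basePiece χ f g₁ g₂ k = (fun x t => profPoly χ x g (⌊bigP D⌋₊ + 1) t) ∨
      basePiece χ f g₁ g₂ k = (fun x t => conj (profPoly χ x g (⌊bigP D⌋₊ + 1) t)) →
      E k k = ((discMean c' χ (fun x t => profPoly χ x g (⌊bigP D⌋₊ + 1) t) : ℝ) : ℂ) := by
    intro k g hk
    simp only [hE_def, discPolar_self, zGradedPiece, discMean_zTwist hZ]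
    rcases hk with hk | hk
    · rw [hk]
    · rw [hk, discMean_conj]
  have hE10 : ‖E 1 0 - M 1 0 * ↑(frakA χ) * ↑(frakP D)‖ ≤ δ * frakA χ * frakP D := by
    simpa [hE_def, hM_def, gradedMainMatrix, discPolar_gradedPiece hZ, basePiece, mul_assoc] using e10 hA
  have hE20 : ‖E 2 0 - M 2 0 * ↑(frakA χ) * ↑(frakP D)‖ ≤ δ * frakA χ * frakP D := by
    simpa [hE_def, hM_def, gradedMainMatrix, discPolar_gradedPiece hZ, basePiece, mul_assoc] using e20 hA
  have hE21 : ‖E 2 1 - M 2 1 * ↑(frakA χ) * ↑(frakP D)‖ ≤ δ * frakA χ * frakP D := by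
    simpa [hE_def, hM_def, gradedMainMatrix, discPolar_gradedPiece hZ, basePiece, mul_assoc] using e21 hA
  have hE00 : E 0 0 = ((discMean c' χ (fun x t => profPoly χ x f (⌊bigP D⌋₊ + 1) t) : ℝ) : ℂ) :=
    diag 0 f (Or.inl rfl)
  have hE11 : E 1 1 = ((discMean c' χ (fun x t => profPoly χ x g₁ (⌊bigP D⌋₊ + 1) t) : ℝ) : ℂ) :=
    diag 1 g₁ (Or.inr rfl)
  have hE22 : E 2 2 = ((discMean c' χ (fun x t => profPoly χ x g₂ (⌊bigP D⌋₊ + 1) t) : ℝ) : ℂ) :=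
    diag 2 g₂ (Or.inr rfl)
  have hM00 : M 0 0 = (mainTermForm f f' : ℂ) := rfl
  have hM11 : M 1 1 = (mainTermForm g₁ g₁' : ℂ) := rfl
  have hM22 : M 2 2 = (mainTermForm g₂ g₂' : ℂ) := rfl
  -- one normaliser `A = 𝔞𝔓`
  set A : ℝ := frakA χ * frakP D with hA_def
  have hAP : 0 ≤ A := mul_nonneg (frakA_nonneg χ) (frakP_nonneg D)
  have conv_re : ∀ {x m : ℝ}, |x - m * frakA χ * frakP D| ≤ δ * frakA χ * frakP D →
      ‖((x : ℝ) : ℂ) - (m : ℂ) * (A : ℂ)‖ ≤ δ * A := by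
    intro x m h
    rw [mul_assoc, mul_assoc, ← hA_def] at h
    exact entry_of_real h
  have conv_cx : ∀ {z X : ℂ}, ‖z - X * ↑(frakA χ) * ↑(frakP D)‖ ≤ δ * frakA χ * frakP D →
      ‖z - X * (A : ℂ)‖ ≤ δ * A := by
    intro z X h
    rw [mul_assoc, mul_assoc, ← Complex.ofReal_mul, ← hA_def] at h
    exact h
  have hall : ∀ a b, ‖E a b - M a b * (A : ℂ)‖ ≤ δ * A := by
    refine entries_of_lower hEsym hMsym ?_ ?_ ?_ (conv_cx hE10) (conv_cx hE20) (conv_cx hE21)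
    · rw [hE00, hM00]; exact conv_re (e00 hA)
    · rw [hE11, hM11]; exact conv_re (e11 hA)
    · rw [hE22, hM22]; exact conv_re (e22 hA)
  have hsum := quadForm_error s E M hall
  have hmean : ((discMean c' χ (zGradedDesign χ f g₁ g₂ s) : ℝ) : ℂ) = ∑ a, ∑ b, s a * conj (s b) * E a b :=
    discMean_gradedDesign f g₁ g₂ s
  have hq : ((gradedQuadForm M s * A : ℝ) : ℂ).re = ((∑ a, ∑ b, s a * conj (s b) * M a b) * (A : ℂ)).re := by
    simp [gradedQuadForm, Complex.mul_re]
  have key : |discMean c' χ (zGradedDesign χ f g₁ g₂ s) - gradedQuadForm M s * A| ≤ (∑ a, ‖s a‖) ^ 2 * (δ * A) := by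
    have h1 : discMean c' χ (zGradedDesign χ f g₁ g₂ s) - gradedQuadForm M s * A =
        ((∑ a, ∑ b, s a * conj (s b) * E a b) - (∑ a, ∑ b, s a * conj (s b) * M a b) * (A : ℂ)).re := by
      rw [Complex.sub_re, ← hmean, Complex.ofReal_re, ← hq, Complex.ofReal_re]
    rw [h1]
    exact (Complex.abs_re_le_norm _).trans hsum
  have hfrac : (∑ a, ‖s a‖) ^ 2 * δ ≤ ε := by
    rw [hδ_def, ← mul_div_assoc, div_le_iff₀ hK0, hK]
    nlinarith [sq_nonneg (∑ a, ‖s a‖)]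
  have hfin : |discMean c' χ (zGradedDesign χ f g₁ g₂ s) - gradedQuadForm M s * A| ≤ ε * A :=
    key.trans (by nlinarith [mul_le_mul_of_nonneg_right hfrac hAP])
  simpa [hA_def, mul_assoc] using hfin

/-- **THE POSITIVITY ENDGAME FOR ANY VALUE TABLES (proved):** if under (A) the discrete mean of SOME tables `F_D`
has main term `m·𝔞𝔓 + o(𝔞𝔓)` (upper half) with `m < 0`, then — Prop. 2.2 (i) and Lemma 2.3 making every discrete
mean `≥ 0` (`discMean_nonneg`) — (A) fails to every large modulus (`𝔞 ≥ a₀ > 0`, `𝔓 > 0`).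
[cite: Zhang2022LandauSiegel, §2 p. 6, Lemma 2.3, Prop. 2.2 (i), (2.15)] -/
theorem eventually_not_assumptionA_of_negative_const {m : ℝ} (hm : m < 0)
    {F : (D : ℕ) → [NeZero D] → (χ : DirichletCharacter ℂ D) → Chr D → ℂ → ℂ}
    (hasymp : ∀ ε : ℝ, 0 < ε → ForAllLarge fun D _ χ => AssumptionA D χ →
      discMean c' χ (F D χ) - m * frakA χ * frakP D ≤ ε * frakA χ * frakP D)
    (h22 : Prop22i) (h23 : Lemma23 c') :
    ∃ D₀ : ℕ, ∀ (D : ℕ) [NeZero D] (χ : DirichletCharacter ℂ D),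
      D₀ ≤ D → χ.IsQuadratic → χ.IsPrimitive → ¬ AssumptionA D χ := by
  have hε : 0 < -m / 2 := by linarith
  obtain ⟨a₀, ha₀, hA⟩ := frakALowerBound_holds
  obtain ⟨D₃, h₃⟩ := frakP_eventually_pos
  obtain ⟨D₁, h₁⟩ := (((hasymp (-m / 2) hε).and h22).and h23).and hA
  refine ⟨max (max D₁ D₃) 3, fun D _ χ hD hq hp hAss => ?_⟩
  have hD₁ : D₁ ≤ D := le_trans (le_trans (le_max_left _ _) (le_max_left _ _)) hD
  have hD₃ : D₃ ≤ D := le_trans (le_trans (le_max_right _ _) (le_max_left _ _)) hD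
  have hD3 : 3 ≤ D := le_trans (le_max_right _ _) hD
  obtain ⟨⟨⟨hmean, h22'⟩, h23'⟩, hA'⟩ := h₁ D χ hD₁ hq hp
  have hup := hmean hAss
  have hA0 : 0 < frakA χ := lt_of_lt_of_le ha₀ (hA' hAss)
  have hP0 : 0 < frakP D := h₃ D hD₃
  have hpos := discMean_nonneg (weights_nonneg_of hD3 h23' h22') (F D χ)
  have hX : 0 < frakA χ * frakP D := mul_pos hA0 hP0
  nlinarith

/-- **THE CARD'S ENDGAME AS A KERNEL IMPLICATION (proved): side tables ∧ degree-1 tables ∧ the degree-2 table `τ₂` ∧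
a non-PSD design ∧ Prop. 2.2 (i) ∧ Lemma 2.3 ⇒ Theorem 1** (`L(1,χ) > c₁(log D)⁻²⁰²²`) — «main-order disagreement on
one pair ⇒ (A)-contradiction from a 3×3 form, no margin fight at `θ = 1`». Every hypothesis OPEN / a CLAIM;
nothing asserted. [cite: Zhang2022LandauSiegel, §1 Theorem 1, §2 p. 6, (2.16)] -/
theorem theorem1_of_gradedCloses (h0 : InClassMean c') (h1 : CrossTable c' 1 X₁) (h21 : DualCrossTable c' 1 Y₁)
    (h2 : TauTwoTable c' X₂) (hC : GradedCloses X₁ Y₁ X₂) (h22 : Prop22i) (h23 : Lemma23 c') : Theorem1 := by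
  obtain ⟨f, f', g₁, g₁', g₂, g₂', s, hf, hg₁, hg₂, hneg⟩ := hC
  refine Skeleton.theorem1_of_eventually_not_assumptionA
    (eventually_not_assumptionA_of_negative_const (F := fun D _ χ => zGradedDesign χ f g₁ g₂ s) hneg
      (fun ε hε => ?_) h22 h23)
  exact (discMean_gradedDesign_asymp h0 h1 h21 h2 h22 h23 hf hg₁ hg₂ s hε).mono
    fun _ _ _ _ _ h hA => (abs_le.mp (h hA)).2

/-- … and Theorem 2 (`L(σ,χ) ≠ 0` for `σ > 1 − c₂(log D)⁻²⁰²⁴`). [cite: Zhang2022LandauSiegel, §1 Theorem 2] -/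
theorem theorem2_of_gradedCloses (h0 : InClassMean c') (h1 : CrossTable c' 1 X₁) (h21 : DualCrossTable c' 1 Y₁)
    (h2 : TauTwoTable c' X₂) (hC : GradedCloses X₁ Y₁ X₂) (h22 : Prop22i) (h23 : Lemma23 c') : Theorem2 :=
  Skeleton.theorem2_of_theorem1 (theorem1_of_gradedCloses h0 h1 h21 h2 hC h22 h23)

end Endgame

/-! ### Part 3 — K2 located: Hermitian main matrix, «not PSD ⇒ closes», and the forcing dichotomy at a kernel pair -/

section Forcing

variable {X₁ Y₁ X₂ : PairFunctional} {f f' g₁ g₁' g₂ g₂' : ℝ → ℂ}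

/-- The main-term matrix is Hermitian (by construction). [cite: Zhang2022LandauSiegel, §2 (2.16)–(2.17)] -/
theorem gradedMainMatrix_conj_symm (X₁ Y₁ X₂ : PairFunctional) (f f' g₁ g₁' g₂ g₂' : ℝ → ℂ) (a b : Fin 3) :
    gradedMainMatrix X₁ Y₁ X₂ f f' g₁ g₁' g₂ g₂' b a = conj (gradedMainMatrix X₁ Y₁ X₂ f f' g₁ g₁' g₂ g₂' a b) := by
  fin_cases a <;> fin_cases b <;> simp [gradedMainMatrix, Complex.conj_ofReal]

/-- … as `Matrix.IsHermitian`. [cite: Zhang2022LandauSiegel, §2 (2.16)–(2.17)] -/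
theorem gradedMainMatrix_isHermitian (X₁ Y₁ X₂ : PairFunctional) (f f' g₁ g₁' g₂ g₂' : ℝ → ℂ) :
    (gradedMainMatrix X₁ Y₁ X₂ f f' g₁ g₁' g₂ g₂').IsHermitian := by
  refine Matrix.IsHermitian.ext fun a b => ?_
  rw [Complex.star_def, ← gradedMainMatrix_conj_symm X₁ Y₁ X₂ f f' g₁ g₁' g₂ g₂' b a]

/-- a Hermitian `3×3` Gram form takes real values (pure algebra). [folklore] -/
private theorem quadForm_conj {M : Fin 3 → Fin 3 → ℂ} (hM : ∀ a b, M b a = conj (M a b)) (s : Fin 3 → ℂ) :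
    conj (∑ a, ∑ b, s a * conj (s b) * M a b) = ∑ a, ∑ b, s a * conj (s b) * M a b := by
  rw [map_sum]
  simp_rw [map_sum, map_mul, Complex.conj_conj]
  rw [Finset.sum_comm]
  refine Finset.sum_congr rfl fun a _ => Finset.sum_congr rfl fun b _ => ?_
  rw [← hM b a]
  ring

/-- the Gram form of the amplitudes `star x` is the matrix quadratic form `x⋆Mx` (pure algebra). [folklore] -/
private theorem quadForm_star (M : Matrix (Fin 3) (Fin 3) ℂ) (x : Fin 3 → ℂ) :
    (∑ a, ∑ b, (star x) a * conj ((star x) b) * M a b) = star x ⬝ᵥ (M *ᵥ x) := by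
  simp only [dotProduct, Matrix.mulVec, Pi.star_apply, Complex.star_def, Complex.conj_conj, Finset.mul_sum]
  refine Finset.sum_congr rfl fun a _ => Finset.sum_congr rfl fun b _ => ?_
  ring

/-- **«Not PSD on some design ⇒ the design closes» (proved):** if for in-class `f, g₁, g₂` the ⟨A⟩-main-term matrix
is not positive semidefinite, `GradedCloses X₁ Y₁ X₂` (the matrix is Hermitian, so some `x⋆Mx` is a negative REAL).
[cite: Zhang2022LandauSiegel, §2 (2.16), §7 Prop 7.1 (7.2)] -/
theorem gradedCloses_of_not_posSemidef (hf : InClassPiece f f') (hg₁ : InClassPiece g₁ g₁') (hg₂ : InClassPiece g₂ g₂')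
    (h : ¬ (gradedMainMatrix X₁ Y₁ X₂ f f' g₁ g₁' g₂ g₂').PosSemidef) : GradedCloses X₁ Y₁ X₂ := by
  set M := gradedMainMatrix X₁ Y₁ X₂ f f' g₁ g₁' g₂ g₂' with hM
  rw [Matrix.posSemidef_iff_dotProduct_mulVec, not_and] at h
  obtain ⟨x, hx⟩ := not_forall.mp (h (gradedMainMatrix_isHermitian X₁ Y₁ X₂ f f' g₁ g₁' g₂ g₂'))
  refine ⟨f, f', g₁, g₁', g₂, g₂', star x, hf, hg₁, hg₂, ?_⟩
  have hreal : (star x ⬝ᵥ (M *ᵥ x)).im = 0 := by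
    rw [← quadForm_star, ← Complex.conj_eq_iff_im]
    exact quadForm_conj (gradedMainMatrix_conj_symm X₁ Y₁ X₂ f f' g₁ g₁' g₂ g₂') (star x)
  rw [Complex.le_def] at hx
  simp only [Complex.zero_re, Complex.zero_im, hreal, and_true, not_le] at hx
  unfold gradedQuadForm
  rw [quadForm_star]
  exact hx

/-- **CARATHÉODORY FORCING ON THE GRADED DESIGN (proved):** if the ⟨A⟩-main-term matrix of `(f, g₁, g₂)` is PSD and
`(f, g₁)` is a KERNEL PAIR (singular `2×2` block: `𝔅(f)·𝔅(g₁) = conj X₁(f,g₁)·X₁(f,g₁)` — the B-AH/AFE modes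
`P_j + Z·conj Q_j` of `KnifeEdge.kernelModeCancellation_of_null`), then the degree-2 table is FORCED:
`X₂(f,g₂)·conj X₁(f,g₁) = Y₁(g₁,g₂)·𝔅(f)` — the card's «`τ₂(G,P_j) = −τ₁(G, conj Q_j)`» (with `X₁ = −𝔅(f)` on a
null mode). [cite: Zhang2022LandauSiegel, §2 (2.16), (2.32), §7 Prop 7.1 (7.2)] -/
theorem gradedForcing (hpsd : (gradedMainMatrix X₁ Y₁ X₂ f f' g₁ g₁' g₂ g₂').PosSemidef)
    (hker : (mainTermForm f f' : ℂ) * (mainTermForm g₁ g₁' : ℂ) = conj (X₁ f f' g₁ g₁') * X₁ f f' g₁ g₁') :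
    X₂ f f' g₂ g₂' * conj (X₁ f f' g₁ g₁') = Y₁ g₁ g₁' g₂ g₂' * (mainTermForm f f' : ℂ) := by
  have h := KnifeEdgeLenZDegree.thirdRow_forced hpsd (by simpa [gradedMainMatrix] using hker)
  simpa [gradedMainMatrix] using h

/-- **K2 LOCATED — the dichotomy (proved):** for in-class `f, g₁, g₂` with `(f, g₁)` a kernel pair, EITHER the
forced-extension identity holds (barrier side: the ⟨A⟩-tables are consistent with positivity one harmonic up —
B-AH⁺), OR `GradedCloses X₁ Y₁ X₂` (an E*-len⁺ inhabitant: (A) refuted by `theorem1_of_gradedCloses` given the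
slots). The card's cheapest falsifier F2 is the left disjunct on ONE pair. [cite: Zhang2022LandauSiegel, §2 (2.16), (2.32), §7 Prop 7.1 (7.2)] -/
theorem gradedForcing_or_closes (hf : InClassPiece f f') (hg₁ : InClassPiece g₁ g₁') (hg₂ : InClassPiece g₂ g₂')
    (hker : (mainTermForm f f' : ℂ) * (mainTermForm g₁ g₁' : ℂ) = conj (X₁ f f' g₁ g₁') * X₁ f f' g₁ g₁') :
    X₂ f f' g₂ g₂' * conj (X₁ f f' g₁ g₁') = Y₁ g₁ g₁' g₂ g₂' * (mainTermForm f f' : ℂ) ∨ GradedCloses X₁ Y₁ X₂ := by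
  by_cases hpsd : (gradedMainMatrix X₁ Y₁ X₂ f f' g₁ g₁' g₂ g₂').PosSemidef
  · exact Or.inl (gradedForcing hpsd hker)
  · exact Or.inr (gradedCloses_of_not_posSemidef hf hg₁ hg₂ hpsd)

/-- **Contrapositive, the test K2 names:** a kernel pair and a third profile VIOLATING the forced identity at main
order close the design. [cite: Zhang2022LandauSiegel, §2 (2.16), §7 Prop 7.1 (7.2)] -/
theorem gradedCloses_of_forcing_violated (hf : InClassPiece f f') (hg₁ : InClassPiece g₁ g₁')
    (hg₂ : InClassPiece g₂ g₂')
    (hker : (mainTermForm f f' : ℂ) * (mainTermForm g₁ g₁' : ℂ) = conj (X₁ f f' g₁ g₁') * X₁ f f' g₁ g₁')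
    (hviol : X₂ f f' g₂ g₂' * conj (X₁ f f' g₁ g₁') ≠ Y₁ g₁ g₁' g₂ g₂' * (mainTermForm f f' : ℂ)) :
    GradedCloses X₁ Y₁ X₂ :=
  (gradedForcing_or_closes hf hg₁ hg₂ hker).resolve_left hviol

end Forcing

end Literature.NumberTheory.LFunctions.Zhang2022.KnifeEdge

end
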